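import Summits.AtomisticToContinuum.HydrodynamicLimit.Theorems.CollisionIsometryCLTAdaptedWeightCLTTLSourceContractionIdentity
import Summits.AtomisticToContinuum.HydrodynamicLimit.Theorems.CollisionIsometryCLTAdaptedWeightCLTTLStubReduction

/-!
# Stub `stub_sourceContraction` of the line `contact-source-duhamel`, helper file 2:
the converse certificate `ConclOn ∧ PastSmallOn ∧ CrossNullOn → SourceContractionOn`
(crux `CollisionIsometryCLT.AdaptedWeightCLT`, stmt-AtomisticToContinuum-14868, rev-12 TIME-LOCAL
crux; `--supports`; namespace `…ContactSourceDuhamel.TimeLocal.SourceContraction`)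

CIRCULARITY CERTIFICATE for the closing stub of the line. `Reduction.stub_reduction` (tree file
`…TLStubReduction.lean`) proves, for `0 < σ < 1/2` under the Duhamel identity and the flow dictionary,
`TailsOn t → PastSmallOn t → CrossNullOn t → SourceContractionOn t → ConclOn t`. This file proves the
CONVERSE at the same level of generality:
  `PastSmallOn t → CrossNullOn t → ConclOn t → SourceContractionOn t`
(`sourceContractionOn_of_conclOn`), and in fact the source-contraction event is negligible in the limit
for EVERY `κ < 1`, not merely for some `κ < 1` (`tendsto_scEvent_of_conclOn`; the registered statement
asks for `∃ κ < 1`, we exhibit `κ := 0`). Hence, modulo past damping and contact-cross-null (the two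
neighbouring stubs) and the two exact inputs, the typed closure statement `SourceContractionOn … t` is
EQUIVALENT to the crux's own conclusion `ConclOn … t` on the same horizon
(`sourceContractionOn_iff_conclOn`): the stub is crux-sized, with no `κ`-margin to exploit.

Proof (measure theory only; the algebra is the wave-1 identity file `…TLSourceContractionIdentity`).
Fix an admissible kernel family, `κ < 1`, `δ > 0`, any `η > 0` (we take `η := 1`), and `N`.
1. On the good set `G_N = {z ∈ Φ.good | the dictionary identity holds at z}` (full local Gibbs
   measure: `HardSphereFlow.ae_mem_good`, `FlowDictionary`, `localGibbsLaw ≪ liouville`) the four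
   functionals `DefectSq, PastSq, XiDevSq, XiCorr` are bounded and jointly measurable on `[0, t] × 𝕋³`
   (`Reduction.bdd_*`, `Reduction.measurable_*`), so the pointwise UPPER half of the Peter–Paul sandwich
   `XiCorr ≤ (1 + 2η) DefectSq + (4η)⁻¹ (PastSq + XiDevSq)` (`SourceContraction.xiCorr_le`) integrates to
   `I_X ≤ (1 + 2η) I_D + (4η)⁻¹ (I_P + I_V)` (`setIntegral_xiCorr_le`).
2. By `SourceContraction.defect_gt_or_of_sc_event`, on `G_N` the source-contraction event
   `{κ I_D + δ < I_X}` forces `I_D > δ / (2(1 + 2η − κ))` or `I_P > ηδ` or `I_V > ηδ`; so the event lies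
   in `G_Nᶜ ∪ {δ/(2(1+2η−κ)) < I_D} ∪ {ηδ < I_P} ∪ {ηδ < I_V}`, of measure
   `≤ 0 + o(1) + o(1) + o(1)` by `ConclOn` (the crux's event IS `{· < I_D}`: `Reduction.cruxIntegrand_eq`),
   `PastSmallOn`, `CrossNullOn` (monotonicity and subadditivity of the outer measure), and the squeeze
   concludes.
`NiceProfiles` and `0 < t` are not used, and the `σ`-window enters only through the boundedness
bookkeeping (`σ < 1/2` makes the torus geometry regular at diameter `hsDiameter σ N ≤ σ`); all three are
kept so that the signature is `stub_reduction`'s with `SourceContractionOn` and `ConclOn` exchanged (and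
`TailsOn` dropped: the tails enter only through `PastSmallOn`/`CrossNullOn`/`ConclOn`).
-/

namespace Summit.AtomisticToContinuum.HydrodynamicLimit.Theorems.ContactSourceDuhamel.TimeLocal
namespace SourceContraction

open scoped BigOperators Topology Classical MeasureTheory ENNReal InnerProductSpace
open Filter Set MeasureTheory
open Literature.Analysis.FluidPDE
open Literature.MathematicalPhysics.KineticTheory (hsDiameter hsDiameter_le localGibbsLaw
  localGibbsLaw_absolutelyContinuous)
open Reduction

noncomputable section

variable {σ : ℝ} {N : ℕ}

/-! ## The crux's conclusion in `DefectSq` form -/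

/-- HYPOTHESIS SIDE of the dictionary: `ConclOn … t` gives, for every admissible kernel family and
`δ > 0`, `P_N{δ < ∫₀ᵗ∫ₓ DefectSq} → 0` (the crux's `let ρb mb ub D q` telescope ζ-reduces and its
integrand is `DefectSq` by `Reduction.cruxIntegrand_eq`, for every `s z x`). -/
theorem tendsto_defect_of_conclOn {a₀ θ₀ : T3 → ℝ} {u₀ : T3 → V3} {Φ : Flows σ} {t : ℝ}
    (h : ConclOn σ a₀ θ₀ u₀ Φ t) {γ C : ℝ} {φ : ℕ → T3 → ℝ} (hγ : 0 < γ) (hγ' : γ ≤ 1 / 15)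
    (hadm : AdmissibleKernel γ C φ) {δ : ℝ} (hδ : 0 < δ) :
    Tendsto (fun N : ℕ => localGibbsLaw σ a₀ u₀ θ₀ N (Φ N)
      {z | δ < ∫ s in Icc 0 t, ∫ x, DefectSq σ N (Φ N) φ s z x}) atTop (𝓝 0) := by
  have h1 := h γ C φ hγ hγ' hadm δ hδ
  refine (tendsto_congr fun N => ?_).2 h1
  congr 1
  refine Set.ext fun z => ?_
  simp only [mem_setOf_eq]
  refine Iff.of_eq (congrArg _ ?_)
  refine setIntegral_congr_fun measurableSet_Icc fun s _ => ?_
  refine integral_congr_ae (ae_of_all _ fun x => ?_)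
  exact (cruxIntegrand_eq (Φ N) φ s z x).symm

/-- GOAL SIDE of the dictionary: conversely, `P_N{δ < ∫₀ᵗ∫ₓ DefectSq} → 0` for every admissible kernel
family and `δ > 0` gives `ConclOn … t`. -/
theorem conclOn_of_tendsto_defect {a₀ θ₀ : T3 → ℝ} {u₀ : T3 → V3} {Φ : Flows σ} {t : ℝ}
    (h : ∀ (γ C : ℝ) (φ : ℕ → T3 → ℝ), 0 < γ → γ ≤ 1 / 15 → AdmissibleKernel γ C φ →
      ∀ δ : ℝ, 0 < δ → Tendsto (fun N : ℕ => localGibbsLaw σ a₀ u₀ θ₀ N (Φ N)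
        {z | δ < ∫ s in Icc 0 t, ∫ x, DefectSq σ N (Φ N) φ s z x}) atTop (𝓝 0)) :
    ConclOn σ a₀ θ₀ u₀ Φ t := by
  intro γ C φ hγ hγ' hadm ρb mb ub D q δ hδ
  have hint : ∀ (n : ℕ) s z x, ((∑ j, ∑ k, D n s z x j k ^ 2) + ‖q n s z x‖ ^ 2) =
      DefectSq σ n (Φ n) φ s z x := fun n s z x => cruxIntegrand_eq (Φ n) φ s z x
  simp only [hint]
  exact h γ C φ hγ hγ' hadm δ hδ

/-- The dictionary as an equivalence: `ConclOn … t` IS `∀ kernels ∀ δ > 0, P_N{δ < ∫₀ᵗ∫ₓ DefectSq} → 0`. -/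
theorem conclOn_iff_tendsto_defect {a₀ θ₀ : T3 → ℝ} {u₀ : T3 → V3} {Φ : Flows σ} {t : ℝ} :
    ConclOn σ a₀ θ₀ u₀ Φ t ↔
      ∀ (γ C : ℝ) (φ : ℕ → T3 → ℝ), 0 < γ → γ ≤ 1 / 15 → AdmissibleKernel γ C φ →
        ∀ δ : ℝ, 0 < δ → Tendsto (fun N : ℕ => localGibbsLaw σ a₀ u₀ θ₀ N (Φ N)
          {z | δ < ∫ s in Icc 0 t, ∫ x, DefectSq σ N (Φ N) φ s z x}) atTop (𝓝 0) :=
  ⟨fun h _ _ _ hγ hγ' hadm _ hδ => tendsto_defect_of_conclOn h hγ hγ' hadm hδ,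
    conclOn_of_tendsto_defect⟩

/-! ## The integrated upper sandwich on the good set -/

/-- Integrating the pointwise upper sandwich `X ≤ a D + b (P + V)` against a measure for which all four
functions are integrable. -/
theorem integral_upper_le {α : Type*} [MeasurableSpace α] {μ : Measure α} {D P V X : α → ℝ}
    {a b : ℝ} (hD : Integrable D μ) (hP : Integrable P μ) (hV : Integrable V μ) (hX : Integrable X μ)
    (h : ∀ᵐ y ∂μ, X y ≤ a * D y + b * (P y + V y)) :
    ∫ y, X y ∂μ ≤ a * ∫ y, D y ∂μ + b * (∫ y, P y ∂μ + ∫ y, V y ∂μ) := by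
  have h1 : Integrable (fun y => a * D y) μ := hD.const_mul a
  have h2 : Integrable (fun y => b * (P y + V y)) μ := (hP.add hV).const_mul b
  calc ∫ y, X y ∂μ ≤ ∫ y, (a * D y + b * (P y + V y)) ∂μ := integral_mono_ae hX (h1.add h2) h
    _ = a * ∫ y, D y ∂μ + b * (∫ y, P y ∂μ + ∫ y, V y ∂μ) := by
        rw [integral_add h1 h2, integral_const_mul, integral_const_mul, integral_add hP hV]

/-- **The integrated upper sandwich on the good set.** For a good datum `z` at which the flow dictionary
holds, a continuous, nonnegative, bounded kernel and `η > 0`: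
`I_X ≤ (1 + 2η) I_D + (4η)⁻¹ (I_P + I_V)` for the iterated integrals over `[0, t] × 𝕋³` of
`XiCorr, DefectSq, PastSq, XiDevSq` (the converse of `Reduction.setIntegral_defectSq_le`; same
integrability bookkeeping, the pointwise input being `SourceContraction.xiCorr_le`). -/
theorem setIntegral_xiCorr_le (hG : (Torus.geometry (Fin 3)).IsHardSphereRegular (hsDiameter σ N))
    (hDu : DuhamelIdentity σ) {Φ : Flow σ N} {z : Cfg N} (hz : z ∈ Φ.good)
    (hdict : ∀ s Δ : ℝ, 0 ≤ Δ →
      (fun i => (Φ.flow (s + Δ) z i).2) = velAfter σ N (Φ.flow s z) (steps σ N (Φ.flow s z) Δ))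
    {φ : ℕ → T3 → ℝ} {Cφ : ℝ} (hφc : Continuous (φ N)) (hφ0 : ∀ y, 0 ≤ φ N y) (hφC : ∀ y, φ N y ≤ Cφ)
    {η : ℝ} (hη : 0 < η) (t : ℝ) :
    ∫ s in Icc 0 t, ∫ x, XiCorr σ N Φ φ s z x ≤
      (1 + 2 * η) * (∫ s in Icc 0 t, ∫ x, DefectSq σ N Φ φ s z x) +
        (4 * η)⁻¹ * ((∫ s in Icc 0 t, ∫ x, PastSq σ N Φ φ s z x) +
          ∫ s in Icc 0 t, ∫ x, XiDevSq σ N Φ φ s z x) := by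
  have hD := integrable_of_bdd t (fun s x => DefectSq σ N Φ φ s z x)
    (measurable_defectSq hz hφc) (bdd_defectSq hz hφ0 hφC)
  have hP := integrable_of_bdd t (fun s x => PastSq σ N Φ φ s z x)
    (measurable_pastSq hG hz hφc) (bdd_pastSq hG hz hφ0 hφC)
  have hV := integrable_of_bdd t (fun s x => XiDevSq σ N Φ φ s z x)
    (measurable_xiDevSq hG hz hφc) (bdd_xiDevSq hG hz hφ0 hφC)
  have hX := integrable_of_bdd t (fun s x => XiCorr σ N Φ φ s z x)
    (measurable_xiCorr hG hz hφc) (bdd_xiCorr hG hz hφ0 hφC)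
  -- inner integrals, `s ∈ [0, t]`
  have hinner : ∀ s ∈ Icc 0 t, ∫ x, XiCorr σ N Φ φ s z x ≤
      (1 + 2 * η) * (∫ x, DefectSq σ N Φ φ s z x) +
        (4 * η)⁻¹ * ((∫ x, PastSq σ N Φ φ s z x) + ∫ x, XiDevSq σ N Φ φ s z x) := fun s hs =>
    integral_upper_le (hD.1 s hs) (hP.1 s hs) (hV.1 s hs) (hX.1 s hs)
      (ae_of_all _ fun x => xiCorr_le hDu hdict φ hη s x)
  -- outer integral
  exact integral_upper_le hD.2 hP.2 hV.2 hX.2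
    ((ae_restrict_iff' measurableSet_Icc).2 (ae_of_all _ hinner))

/-! ## The source-contraction event is negligible for EVERY `κ < 1` -/

/-- **NO `κ`-MARGIN.** For `0 < σ < 1/2`, under the Duhamel identity and the flow dictionary, at a horizon
`t` where the past is damped, the contact cross is null and the crux's conclusion holds on `[0, t]`:
for every admissible kernel family, EVERY `κ < 1` and every `δ > 0`,
`P_N{κ ∫₀ᵗ∫ₓ DefectSq + δ < ∫₀ᵗ∫ₓ XiCorr} → 0`. See the module docstring for the proof. -/
theorem tendsto_scEvent_of_conclOn (hσ : 0 < σ) (hσ2 : σ < 2⁻¹) (hDu : DuhamelIdentity σ)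
    (hFD : FlowDictionary σ) {a₀ θ₀ : T3 → ℝ} {u₀ : T3 → V3} {Φ : Flows σ} {t : ℝ}
    (hPast : PastSmallOn σ a₀ θ₀ u₀ Φ t) (hCross : CrossNullOn σ a₀ θ₀ u₀ Φ t)
    (hConcl : ConclOn σ a₀ θ₀ u₀ Φ t) {γ C : ℝ} {φ : ℕ → T3 → ℝ} (hγ : 0 < γ) (hγ' : γ ≤ 1 / 15)
    (hadm : AdmissibleKernel γ C φ) {κ : ℝ} (hκ : κ < 1) {δ : ℝ} (hδ : 0 < δ) :
    Tendsto (fun N : ℕ => localGibbsLaw σ a₀ u₀ θ₀ N (Φ N)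
      {z | κ * (∫ s in Icc 0 t, ∫ x, DefectSq σ N (Φ N) φ s z x) + δ <
        ∫ s in Icc 0 t, ∫ x, XiCorr σ N (Φ N) φ s z x}) atTop (𝓝 0) := by
  -- any `η > 0` will do; keep it symbolic
  obtain ⟨η, hη⟩ : ∃ η : ℝ, 0 < η := ⟨1, one_pos⟩
  have hk : 0 < 2 * (1 + 2 * η - κ) := by linarith
  have hδD : 0 < δ / (2 * (1 + 2 * η - κ)) := div_pos hδ hk
  have hδP : 0 < η * δ := mul_pos hη hδ
  have hBD := tendsto_defect_of_conclOn hConcl hγ hγ' hadm hδD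
  have hBP := hPast γ C φ hγ hγ' hadm _ hδP
  have hBV := hCross γ C φ hγ hγ' hadm _ hδP
  refine tendsto_of_tendsto_of_tendsto_of_le_of_le tendsto_const_nhds
    (by simpa using (hBD.add hBP).add hBV) (fun _ => zero_le) fun n => ?_
  -- fixed `n`: the source-contraction event lies in `(good ∩ dictionary)ᶜ ∪ bad_D ∪ bad_P ∪ bad_V`
  have hG : (Torus.geometry (Fin 3)).IsHardSphereRegular (hsDiameter σ n) :=
    Torus.isHardSphereRegular_geometry ((hsDiameter_le hσ.le n).trans_lt hσ2)
  have hφc : Continuous (φ n) := (hadm.1 n).continuous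
  have hφ0 : ∀ y, 0 ≤ φ n y := hadm.2.1 n
  have hφC : ∀ y, φ n y ≤ C * ((n : ℝ) + 1) ^ (3 * γ) := hadm.2.2.2.2.1 n
  -- the good set
  set Gd : Set (Cfg n) := {z | z ∈ (Φ n).good ∧ ∀ s Δ : ℝ, 0 ≤ Δ →
    (fun i => ((Φ n).flow (s + Δ) z i).2) =
      velAfter σ n ((Φ n).flow s z) (steps σ n ((Φ n).flow s z) Δ)} with hGd
  have hnull : localGibbsLaw σ a₀ u₀ θ₀ n (Φ n) Gdᶜ = 0 := by
    have hae : ∀ᵐ z ∂(localGibbsLaw σ a₀ u₀ θ₀ n (Φ n)), z ∈ Gd :=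
      (localGibbsLaw_absolutelyContinuous σ a₀ u₀ θ₀ n (Φ n)).ae_le
        (((Φ n).ae_mem_good).and (hFD n (Φ n)))
    exact ae_iff.1 hae
  -- on the good set, outside the three bad events, the source-contraction event fails
  have hsub : {z | κ * (∫ s in Icc 0 t, ∫ x, DefectSq σ n (Φ n) φ s z x) + δ <
        ∫ s in Icc 0 t, ∫ x, XiCorr σ n (Φ n) φ s z x} ⊆
      ((Gdᶜ ∪ {z | δ / (2 * (1 + 2 * η - κ)) < ∫ s in Icc 0 t, ∫ x, DefectSq σ n (Φ n) φ s z x}) ∪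
        {z | η * δ < ∫ s in Icc 0 t, ∫ x, PastSq σ n (Φ n) φ s z x}) ∪
        {z | η * δ < ∫ s in Icc 0 t, ∫ x, XiDevSq σ n (Φ n) φ s z x} := by
    intro z hzE
    by_contra hnot
    simp only [mem_union, mem_compl_iff, mem_setOf_eq, not_or, not_not, not_lt] at hnot
    obtain ⟨⟨⟨hzG, hID⟩, hIP⟩, hIV⟩ := hnot
    have hup := setIntegral_xiCorr_le hG hDu hzG.1 hzG.2 hφc hφ0 hφC hη t
    have hE : κ * (∫ s in Icc 0 t, ∫ x, DefectSq σ n (Φ n) φ s z x) + δ <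
        ∫ s in Icc 0 t, ∫ x, XiCorr σ n (Φ n) φ s z x := hzE
    rcases defect_gt_or_of_sc_event hη hκ hup hE with h | h | h
    · exact (not_lt.2 hID) h
    · exact (not_lt.2 hIP) h
    · exact (not_lt.2 hIV) h
  calc localGibbsLaw σ a₀ u₀ θ₀ n (Φ n)
        {z | κ * (∫ s in Icc 0 t, ∫ x, DefectSq σ n (Φ n) φ s z x) + δ <
          ∫ s in Icc 0 t, ∫ x, XiCorr σ n (Φ n) φ s z x}
      ≤ localGibbsLaw σ a₀ u₀ θ₀ n (Φ n)
          (((Gdᶜ ∪ {z | δ / (2 * (1 + 2 * η - κ)) <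
              ∫ s in Icc 0 t, ∫ x, DefectSq σ n (Φ n) φ s z x}) ∪
            {z | η * δ < ∫ s in Icc 0 t, ∫ x, PastSq σ n (Φ n) φ s z x}) ∪
            {z | η * δ < ∫ s in Icc 0 t, ∫ x, XiDevSq σ n (Φ n) φ s z x}) := measure_mono hsub
    _ ≤ localGibbsLaw σ a₀ u₀ θ₀ n (Φ n) Gdᶜ +
          localGibbsLaw σ a₀ u₀ θ₀ n (Φ n)
            {z | δ / (2 * (1 + 2 * η - κ)) < ∫ s in Icc 0 t, ∫ x, DefectSq σ n (Φ n) φ s z x} +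
          localGibbsLaw σ a₀ u₀ θ₀ n (Φ n)
            {z | η * δ < ∫ s in Icc 0 t, ∫ x, PastSq σ n (Φ n) φ s z x} +
          localGibbsLaw σ a₀ u₀ θ₀ n (Φ n)
            {z | η * δ < ∫ s in Icc 0 t, ∫ x, XiDevSq σ n (Φ n) φ s z x} :=
        (measure_union_le _ _).trans (add_le_add ((measure_union_le _ _).trans
          (add_le_add (measure_union_le _ _) le_rfl)) le_rfl)
    _ = _ := by rw [hnull, zero_add]

/-! ## The converse certificate and the equivalence -/

/-- **CONVERSE OF THE REDUCTION** (registered anchor `sourceContractionOn_of_conclOn`; the signature of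
`Reduction.stub_reduction` with `SourceContractionOn` and `ConclOn` exchanged and `TailsOn` dropped): for
`0 < σ < 1/2`, under the Duhamel identity and the flow dictionary, at every horizon `t > 0`, past
damping, contact-cross-null and the crux's conclusion on `[0, t]` imply source contraction on `[0, t]` —
with `κ := 0` (any `κ < 1` works: `tendsto_scEvent_of_conclOn`). `NiceProfiles` and `0 < t` are not
used. -/
theorem sourceContractionOn_of_conclOn :
    ∀ σ : ℝ, 0 < σ → σ < 2⁻¹ → DuhamelIdentity σ → FlowDictionary σ →
      ∀ (a₀ θ₀ : T3 → ℝ) (u₀ : T3 → V3), NiceProfiles a₀ θ₀ u₀ → ∀ Φ : Flows σ,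
        ∀ t : ℝ, 0 < t → PastSmallOn σ a₀ θ₀ u₀ Φ t → CrossNullOn σ a₀ θ₀ u₀ Φ t →
          ConclOn σ a₀ θ₀ u₀ Φ t → SourceContractionOn σ a₀ θ₀ u₀ Φ t :=
  fun _ hσ hσ2 hDu hFD _ _ _ _ _ _ _ hPast hCross hConcl _ _ _ hγ hγ' hadm =>
    ⟨0, zero_lt_one, fun _ hδ =>
      tendsto_scEvent_of_conclOn hσ hσ2 hDu hFD hPast hCross hConcl hγ hγ' hadm zero_lt_one hδ⟩

/-- **THE STUB IS CRUX-SIZED.** For `0 < σ < 1/2`, under the Duhamel identity and the flow dictionary,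
for nice profiles, at every horizon `t > 0` with tails, past damping and contact-cross-null on `[0, t]`:
`SourceContractionOn σ a₀ θ₀ u₀ Φ t ↔ ConclOn σ a₀ θ₀ u₀ Φ t` (`→`: `Reduction.stub_reduction`;
`←`: `sourceContractionOn_of_conclOn`). -/
theorem sourceContractionOn_iff_conclOn :
    ∀ σ : ℝ, 0 < σ → σ < 2⁻¹ → DuhamelIdentity σ → FlowDictionary σ →
      ∀ (a₀ θ₀ : T3 → ℝ) (u₀ : T3 → V3), NiceProfiles a₀ θ₀ u₀ → ∀ Φ : Flows σ,
        ∀ t : ℝ, 0 < t → TailsOn σ a₀ θ₀ u₀ Φ t → PastSmallOn σ a₀ θ₀ u₀ Φ t →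
          CrossNullOn σ a₀ θ₀ u₀ Φ t →
            (SourceContractionOn σ a₀ θ₀ u₀ Φ t ↔ ConclOn σ a₀ θ₀ u₀ Φ t) :=
  fun σ hσ hσ2 hDu hFD a₀ θ₀ u₀ hnice Φ t ht hT hPast hCross =>
    ⟨stub_reduction σ hσ hσ2 hDu hFD a₀ θ₀ u₀ hnice Φ t ht hT hPast hCross,
      sourceContractionOn_of_conclOn σ hσ hσ2 hDu hFD a₀ θ₀ u₀ hnice Φ t ht hPast hCross⟩

end

end SourceContraction
end Summit.AtomisticToContinuum.HydrodynamicLimit.Theorems.ContactSourceDuhamel.TimeLocal
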